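import Summits.QuantumFields.YangMills.Theorems.BalabanUVNodesN20HellingerRoadBoundedCurrent
import Summits.QuantumFields.YangMills.Theorems.BalabanUVNodesN19TameHellingerLetterRegimeFree

/-!
# BalabanUVNodes ∕ node N20 (NE7b) — THE REFRESH-PROCESS ROAD, REGIME-FREE AND ONE-TILT, END TO END: two abstract refresh processes (per-run scalars) + radii +
# ONE tame tilt branch ⇒ the (H) letter; + (R′) + ((R‑c) or a bounded source current) ⇒ `HybridNE7` at the key's carriers

Cell `pub-ymgap` (HUMAN RULING D-0062 Track A ∕ director-ym R399 (3a) second-wave width seats), WIDTH SEAT `pub-ymgap-dag-n20-w5` (node n20 = NE7b),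
generation g5, CLAIM-1 ∕ INTENT-1 (bus 2026-08-28T11:06:37Z).  Key item K3⁸ `SpineGivenEndpointR13SepCoPHV` (stmt-QuantumFields-27366; skeleton of record v6
b4e55110ab73e679, stub `stub_expansion13HV`) — K3⁷ stmt-QuantumFields-20544 aside; filed `--kind proof --supports … --as helper`.  COUNT-NEUTRAL.  THEOREMS ONLY
(0 `def`, 0 `instance`, 0 `notation`, 0 `sorry`).  ADDITIVE — imports this seat's `…N20HellingerRoadBoundedCurrent` (p626582; hence the capstone p623765
`exists_hybridNE7_of_affinityDefectLetter_and_response`, p622199 `classWildMass_summable_of_refreshProcess`, p621610 `wildMass_summable_pair`) and dag-n19-w4 g8's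
`…N19TameHellingerLetterRegimeFree` (`affinityDefectLetter_of_tameTilt`) BY NAME; nothing of theirs restated; modifies nothing.

WHY.  dag-n19-w4 g8 (`…N19TameHellingerLetterRegimeFree`) showed that the TAME REGIME letter `(K₀) (hreg)` and the SECOND tilt branch `φB` of the tame Hellinger
letter are IDLE (the radius letter `Σ 1∕r_K < ∞` forces `r_K ≥ 2` eventually; one origin-disc branch then gives the s-uniform variance letter).  This seat's refresh-process
supplier (p622199) and V-side capstone (p623765 §3) were typed against the OLD letter (p618979) and still display `(K₀) (hreg)` and `φB`.  THIS FILE re-issues them through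
the regime-free letter and types p622199's READING (ii) («per-run scalars — not typed»): each run's refresh process carries ITS OWN scalars and event type.
* §1 ★★★ `affinityDefectLetter_of_refreshProcesses_and_tameTilt` — carriers `T : ℕ → Finset ι`, positive class weights `A, B` on `|t| ≤ l₀`, wild sets `W K t ⊆ T K`;
  for EACH run an abstract refresh process with ITS OWN scalars (`θ ≥ 0`, `Λ + ζ < θ`, `κ₁(θ − Λ − ζ) > 2`, `C₀ ≥ 0`, budget `b`), its price ∕ rate ∕ entropy letters
  and its MODELLING letter for that run's relative wild mass ((V‑a)); radii `r_K > 0`, `Σ 1∕r_K < ∞` ((V‑b) = (YG)); ONE bound `𝔅 ≥ 0` and ONE branch per `(K,t)` of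
  `log(Σ_{T∖W} A e^{z(log B − log A)} ∕ Σ_{T∖W} A)` on `closedBall 0 r_K` bounded by `𝔅` ((KR) on tame components) ⇒ the (H) letter `∃ η ≥ 0, Σ_K √η_K < ∞,
  1 − Σ_{T K} √(p_{A,K,t} p_{B,K,t}) ≤ η_K`.  NO regime, NO `K₀`, NO second branch.  ★ `hellingerRate_of_refreshProcesses_and_tameTilt` — the ρ-shape.
* §2 ★★★ `exists_hybridNE7_of_refreshProcesses_tameTilt_and_response` — p623765 §3 `exists_hybridNE7_of_refreshProcesses_tameTilts_and_response` RE-ISSUED through §1: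
  class weights DIFFERENTIABLE in the source, the E1∕E2 dictionary, §1's letters, (R′) `|E_{q_{K,s}}[B'∕B − A'∕A]| ≤ R₁ K` with `Σ R₁ < ∞`, (R‑c) `Σ ½(p+q)(A'∕A − m)² ≤ χ`
  ⇒ `∃ η Wsh shA shB`, (H) for `η`, `Σ√η < ∞`, `0 ≤ Wsh ≤ √(2η)`, `Wsh < 1` at every key, and
  `HybridNE7 l₀ vol T A B (fun _ _ => ∅) (fun _ => 0) shA shB Wsh (K ↦ l₀·(R₁ K + 2√(2η_K)√χ)∕vol)` — regime, `K₀`, `φB` GONE from the end-to-end list.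
* §3 ★★ `exists_hybridNE7_of_refreshProcesses_tameTilt_and_boundedCurrent` — the same with (R‑c) REPLACED by the bounded source current `|A' K s τ| ≤ M·A K s τ`
  (p626582 `exists_hybridNE7_of_affinityDefectLetter_response_boundedCurrent` BY NAME): the END-TO-END letter list of the refresh-process road at a key is then
  (V‑a) refresh letters ×2 + modelling letters ×2 + radii + ONE tilt branch + `𝔅` + (R′) + bounded current.
* §4 toys (A6, contentful): ★ `toy_affinityDefectLetter_emptyProcesses` — §1 APPLIED END TO END on the one-class carrier with two EMPTY refresh processes (`θ = 10`,
  `Λ = 4 log 2`, `ζ = e^{−10}`, `κ₁ = 1`, `Z₀ = C₀ = b = 0`, radii `r_K = 2·2^K`, branch `φ = 0`, `𝔅 = 0`): EVERY antecedent discharged by a genuine witness, the (H) letter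
  exhibited; ★ `toy_hybridNE7_emptyProcesses` — §3 END TO END on the same carrier (`A = B = 1`, `A' = B' = 0`, `R₁ = 0`, `M = 0`, `l₀ = 0`, `vol = 1`): `HybridNE7` INHABITED.
READING (located, nothing proposed).  (i) The `SlotDom`-road twin of §2 is dag-n20-w4 g6's `exists_hybridNE7_of_slotDoms_kpMargin_and_response`; the keyed-gas supplier
of the ONE tilt branch is dag-n19-w4 g8's `affinityDefectLetter_of_kpMargin` — cited, not imported (carriers here stay abstract).  (ii) What stays lettered is unchanged in
kind: (V‑a)'s residue ((KR‑dc), (PEND), positions ∕ births), (KR), (V‑b) = (YG), (R′), and (R‑c) or the bounded current; three binders FEWER, no letter added.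

HONEST FRAMING.  [folklore] by-name composition of four LANDED files on hypothesis SHAPES + two toys; EVERY letter — the two refresh processes and their MODELLING
inequalities ((V‑a): idea-3 g13's READING of [LF‑II] (1.79)–(1.85), re-priced located A∧B by CRIT-1 g6, produced by nobody), the radii ((V‑b) = (YG), two-run,
UNPRINTED for d = 4), the tilt branch ((KR) on tame components), (R′) (two-run, UNPRINTED), (R‑c) ∕ the bounded current — is a HYPOTHESIS produced by nobody; NO
estimate of Bałaban's programme is proved; nothing of Bałaban's asserted or instantiated (no `Provisos₁₃SepCoPH` tuple — K0⁷ OPEN); NE7 ∕ NE7b ∕ NE7c NOT PRINTED as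
two-run statements for d = 4 and NOT proved; N19′ ∕ N20 ∕ N21 NOT discharged; K3⁸ OPEN (v6 STANDS), K3⁷ aside, neither claimed; no summit statement is proved by this
seat; counts UNMOVED (typed 28∕28 · discharged 5∕28; 5∕27 excl. NODE O).  One finite four-torus programme at fixed ε — NOT ℝ⁴, NOT infinite volume, NOT OS, NOT a mass gap, NOT
the Clay problem (R4 closes the conditional finite-𝕋⁴ rung `BalabanLadder.UV` only).  0 `def`; 0 `sorry`; standard axioms; no cite tags.
-/

noncomputable section
namespace Summit.QuantumFields.YangMills.BalabanUVNodes.N20RefreshProcessRoadRegimeFree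

open Finset
open Literature.MathematicalPhysics.QuantumFieldTheory.Balaban1983to89
open T4MatchingAssembly (HybridNE7)
open Summit.QuantumFields.YangMills.BalabanUVNodes.N20OverAgeRefreshProcess (wildMass_summable_pair)
open Summit.QuantumFields.YangMills.BalabanUVNodes.N20OverAgeRefreshProcessAtClassWeights (classWildMass_summable_of_refreshProcess)
open Summit.QuantumFields.YangMills.BalabanUVNodes.N19TameConditionedHellingerLetterAlongK (exists_summable_sqrt_rate)
open Summit.QuantumFields.YangMills.BalabanUVNodes.N19TameHellingerLetterRegimeFree (affinityDefectLetter_of_tameTilt)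
open Summit.QuantumFields.YangMills.BalabanUVNodes.N20HellingerRoadCapstone (exists_hybridNE7_of_affinityDefectLetter_and_response)
open Summit.QuantumFields.YangMills.BalabanUVNodes.N20HellingerRoadBoundedCurrent (exists_hybridNE7_of_affinityDefectLetter_response_boundedCurrent)

variable {ι α β : Type*}

/-! ## §1 The (H) letter from two refresh processes (per-run scalars), the radii and ONE tame tilt branch — regime-free [folklore + by-name] -/
section Letter
variable [DecidableEq ι] {l₀ : ℝ}

/-- **★★★ THE (H) LETTER FROM TWO REFRESH PROCESSES AND ONE TAME TILT — REGIME-FREE, PER-RUN SCALARS** [folklore; junction BY NAME of p622199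
`classWildMass_summable_of_refreshProcess` (×2), p621610 `wildMass_summable_pair` and dag-n19-w4 g8 `affinityDefectLetter_of_tameTilt`].  On the carrier shapes of the
key — `T : ℕ → Finset ι`, class weights `A, B : ℕ → ℝ → ι → ℝ` positive on `|t| ≤ l₀`, wild sets `W K t ⊆ T K` — assume: for EACH run an abstract refresh process
(event sets `U`, factors `0 ≤ w ≤ e^{−P}`, epoch lengths `ℓ` with `θ·ℓ ≤ P∕2`, entropy `Σ_U e^{−P∕2} ≤ Z₀ + ζ m`) with ITS OWN scalars `θ ≥ 0`, `Λ + ζ < θ`,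
`κ₁(θ − Λ − ζ) > 2`, `C₀ ≥ 0`, budget `b`, and its MODELLING letter bounding that run's relative wild mass by `C₀ ×` any upper bound of the over-age pattern sums
((V‑a), produced by nobody); radii `r_K > 0` with `Σ_K 1∕r_K < ∞` ((V‑b) = (YG)); ONE bound `𝔅 ≥ 0` and, at every `(K,t)`, ONE branch `φ` of
`log(Σ_{T∖W} A e^{z(log B − log A)} ∕ Σ_{T∖W} A)` on `closedBall 0 r_K` with `‖φ‖ ≤ 𝔅` ((KR) on tame components).  Conclusion: `∃ η ≥ 0` with `Σ_K √η_K < ∞` and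
`1 − Σ_{T K} √(p_{A,K,t}·p_{B,K,t}) ≤ η_K` for all `K`, `|t| ≤ l₀`.  NO tame regime, NO `K₀`, NO second branch. -/
theorem affinityDefectLetter_of_refreshProcesses_and_tameTilt (T : ℕ → Finset ι) (A B : ℕ → ℝ → ι → ℝ)
    (hA : ∀ K t, |t| ≤ l₀ → ∀ τ ∈ T K, 0 < A K t τ) (hB : ∀ K t, |t| ≤ l₀ → ∀ τ ∈ T K, 0 < B K t τ)
    (W : ℕ → ℝ → Finset ι) (hW : ∀ K t, W K t ⊆ T K)
    -- run A's refresh process, with its own scalars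
    {θA ΛA ζA κA ZA CA : ℝ} (bA : ℝ) (hθA : 0 ≤ θA) (hΛθA : ΛA + ζA < θA) (hκA : 2 < κA * (θA - ΛA - ζA)) (hCA : 0 ≤ CA)
    (UA : ℕ → ℝ → ℕ → Finset α) (wA ℓA PA : ℕ → ℝ → ℕ → α → ℝ)
    (hwA0 : ∀ K t m, ∀ j ∈ UA K t m, 0 ≤ wA K t m j)
    (hwA : ∀ K t m, ∀ j ∈ UA K t m, wA K t m j ≤ Real.exp (-PA K t m j))
    (hθPA : ∀ K t m, ∀ j ∈ UA K t m, θA * ℓA K t m j ≤ PA K t m j / 2)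
    (hZA : ∀ K t (m : ℕ), ∑ j ∈ UA K t m, Real.exp (-(PA K t m j / 2)) ≤ ZA + ζA * m)
    (hmodelA : ∀ (K : ℕ) (t : ℝ), |t| ≤ l₀ → 1 ≤ K → ∀ s : ℝ,
      (∀ M : ℕ, ∑ m ∈ range M, (if bA + κA * Real.log (K : ℝ) ≤ (m : ℝ) then
          Real.exp (ΛA * m) * ∑ S ∈ (UA K t m).powerset with ((m : ℝ) - bA ≤ ∑ j ∈ S, ℓA K t m j), ∏ j ∈ S, wA K t m j
        else 0) ≤ s) →
      (∑ τ ∈ W K t, A K t τ) / (∑ σ ∈ T K, A K t σ) ≤ CA * s)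
    -- run B's refresh process, with its own scalars and event type
    {θB ΛB ζB κB ZB CB : ℝ} (bB : ℝ) (hθB : 0 ≤ θB) (hΛθB : ΛB + ζB < θB) (hκB : 2 < κB * (θB - ΛB - ζB)) (hCB : 0 ≤ CB)
    (UB : ℕ → ℝ → ℕ → Finset β) (wB ℓB PB : ℕ → ℝ → ℕ → β → ℝ)
    (hwB0 : ∀ K t m, ∀ j ∈ UB K t m, 0 ≤ wB K t m j)
    (hwB : ∀ K t m, ∀ j ∈ UB K t m, wB K t m j ≤ Real.exp (-PB K t m j))
    (hθPB : ∀ K t m, ∀ j ∈ UB K t m, θB * ℓB K t m j ≤ PB K t m j / 2)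
    (hZB : ∀ K t (m : ℕ), ∑ j ∈ UB K t m, Real.exp (-(PB K t m j / 2)) ≤ ZB + ζB * m)
    (hmodelB : ∀ (K : ℕ) (t : ℝ), |t| ≤ l₀ → 1 ≤ K → ∀ s : ℝ,
      (∀ M : ℕ, ∑ m ∈ range M, (if bB + κB * Real.log (K : ℝ) ≤ (m : ℝ) then
          Real.exp (ΛB * m) * ∑ S ∈ (UB K t m).powerset with ((m : ℝ) - bB ≤ ∑ j ∈ S, ℓB K t m j), ∏ j ∈ S, wB K t m j
        else 0) ≤ s) →
      (∑ τ ∈ W K t, B K t τ) / (∑ σ ∈ T K, B K t σ) ≤ CB * s)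
    -- the radii, ONE bound, ONE tilt branch (dag-n19-w4 g8's regime-free tame letter)
    (r : ℕ → ℝ) (hr : ∀ K, 0 < r K) (hrs : Summable fun K => 1 / r K)
    {𝔅 : ℝ} (h𝔅 : 0 ≤ 𝔅)
    (htilt : ∀ K t, |t| ≤ l₀ → ∃ φ : ℂ → ℂ,
      DifferentiableOn ℂ φ (Metric.closedBall 0 (r K)) ∧
      (∀ s ∈ Metric.closedBall (0:ℂ) (r K), Complex.exp (φ s)
        = (∑ τ ∈ T K \ W K t, (A K t τ : ℂ) * Complex.exp (s * ((Real.log (B K t τ) - Real.log (A K t τ) : ℝ) : ℂ)))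
            / ∑ τ ∈ T K \ W K t, (A K t τ : ℂ)) ∧
      (∀ s ∈ Metric.closedBall (0:ℂ) (r K), ‖φ s‖ ≤ 𝔅)) :
    ∃ η : ℕ → ℝ, (∀ K, 0 ≤ η K) ∧ Summable (fun K => Real.sqrt (η K)) ∧
      ∀ K t, |t| ≤ l₀ →
        1 - ∑ τ ∈ T K, Real.sqrt ((A K t τ / ∑ σ ∈ T K, A K t σ) * (B K t τ / ∑ σ ∈ T K, B K t σ)) ≤ η K := by
  obtain ⟨wm, hwm, hws, hwildA, hwildB⟩ := wildMass_summable_pair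
    (classWildMass_summable_of_refreshProcess T A hA W hW bA hθA hΛθA hκA hCA UA wA ℓA PA hwA0 hwA hθPA hZA hmodelA)
    (classWildMass_summable_of_refreshProcess T B hB W hW bB hθB hΛθB hκB hCB UB wB ℓB PB hwB0 hwB hθPB hZB hmodelB)
  exact affinityDefectLetter_of_tameTilt T A B hA hB W hW wm hwm hwildA hwildB hws r hr hrs h𝔅 htilt

/-- **★ COROLLARY — THE SUMMABLE HELLINGER RATE FROM TWO REFRESH PROCESSES AND ONE TAME TILT, REGIME-FREE** [folklore]: under the hypotheses of
`affinityDefectLetter_of_refreshProcesses_and_tameTilt` there is a SUMMABLE `ρ ≥ 0` with `√(1 − Σ_{T K} √(p_{A,K,t}·p_{B,K,t})) ≤ ρ_K` for all `K`, `|t| ≤ l₀`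
(p618979 `exists_summable_sqrt_rate` BY NAME) — the input shape of the per-set-TV ∕ class-law roads. -/
theorem hellingerRate_of_refreshProcesses_and_tameTilt (T : ℕ → Finset ι) (A B : ℕ → ℝ → ι → ℝ)
    (hA : ∀ K t, |t| ≤ l₀ → ∀ τ ∈ T K, 0 < A K t τ) (hB : ∀ K t, |t| ≤ l₀ → ∀ τ ∈ T K, 0 < B K t τ)
    (W : ℕ → ℝ → Finset ι) (hW : ∀ K t, W K t ⊆ T K)
    {θA ΛA ζA κA ZA CA : ℝ} (bA : ℝ) (hθA : 0 ≤ θA) (hΛθA : ΛA + ζA < θA) (hκA : 2 < κA * (θA - ΛA - ζA)) (hCA : 0 ≤ CA)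
    (UA : ℕ → ℝ → ℕ → Finset α) (wA ℓA PA : ℕ → ℝ → ℕ → α → ℝ)
    (hwA0 : ∀ K t m, ∀ j ∈ UA K t m, 0 ≤ wA K t m j)
    (hwA : ∀ K t m, ∀ j ∈ UA K t m, wA K t m j ≤ Real.exp (-PA K t m j))
    (hθPA : ∀ K t m, ∀ j ∈ UA K t m, θA * ℓA K t m j ≤ PA K t m j / 2)
    (hZA : ∀ K t (m : ℕ), ∑ j ∈ UA K t m, Real.exp (-(PA K t m j / 2)) ≤ ZA + ζA * m)
    (hmodelA : ∀ (K : ℕ) (t : ℝ), |t| ≤ l₀ → 1 ≤ K → ∀ s : ℝ,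
      (∀ M : ℕ, ∑ m ∈ range M, (if bA + κA * Real.log (K : ℝ) ≤ (m : ℝ) then
          Real.exp (ΛA * m) * ∑ S ∈ (UA K t m).powerset with ((m : ℝ) - bA ≤ ∑ j ∈ S, ℓA K t m j), ∏ j ∈ S, wA K t m j
        else 0) ≤ s) →
      (∑ τ ∈ W K t, A K t τ) / (∑ σ ∈ T K, A K t σ) ≤ CA * s)
    {θB ΛB ζB κB ZB CB : ℝ} (bB : ℝ) (hθB : 0 ≤ θB) (hΛθB : ΛB + ζB < θB) (hκB : 2 < κB * (θB - ΛB - ζB)) (hCB : 0 ≤ CB)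
    (UB : ℕ → ℝ → ℕ → Finset β) (wB ℓB PB : ℕ → ℝ → ℕ → β → ℝ)
    (hwB0 : ∀ K t m, ∀ j ∈ UB K t m, 0 ≤ wB K t m j)
    (hwB : ∀ K t m, ∀ j ∈ UB K t m, wB K t m j ≤ Real.exp (-PB K t m j))
    (hθPB : ∀ K t m, ∀ j ∈ UB K t m, θB * ℓB K t m j ≤ PB K t m j / 2)
    (hZB : ∀ K t (m : ℕ), ∑ j ∈ UB K t m, Real.exp (-(PB K t m j / 2)) ≤ ZB + ζB * m)
    (hmodelB : ∀ (K : ℕ) (t : ℝ), |t| ≤ l₀ → 1 ≤ K → ∀ s : ℝ,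
      (∀ M : ℕ, ∑ m ∈ range M, (if bB + κB * Real.log (K : ℝ) ≤ (m : ℝ) then
          Real.exp (ΛB * m) * ∑ S ∈ (UB K t m).powerset with ((m : ℝ) - bB ≤ ∑ j ∈ S, ℓB K t m j), ∏ j ∈ S, wB K t m j
        else 0) ≤ s) →
      (∑ τ ∈ W K t, B K t τ) / (∑ σ ∈ T K, B K t σ) ≤ CB * s)
    (r : ℕ → ℝ) (hr : ∀ K, 0 < r K) (hrs : Summable fun K => 1 / r K)
    {𝔅 : ℝ} (h𝔅 : 0 ≤ 𝔅)
    (htilt : ∀ K t, |t| ≤ l₀ → ∃ φ : ℂ → ℂ,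
      DifferentiableOn ℂ φ (Metric.closedBall 0 (r K)) ∧
      (∀ s ∈ Metric.closedBall (0:ℂ) (r K), Complex.exp (φ s)
        = (∑ τ ∈ T K \ W K t, (A K t τ : ℂ) * Complex.exp (s * ((Real.log (B K t τ) - Real.log (A K t τ) : ℝ) : ℂ)))
            / ∑ τ ∈ T K \ W K t, (A K t τ : ℂ)) ∧
      (∀ s ∈ Metric.closedBall (0:ℂ) (r K), ‖φ s‖ ≤ 𝔅)) :
    ∃ ρ : ℕ → ℝ, Summable ρ ∧ (∀ K, 0 ≤ ρ K) ∧ ∀ K t, |t| ≤ l₀ →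
      Real.sqrt (1 - ∑ τ ∈ T K, Real.sqrt ((A K t τ / ∑ σ ∈ T K, A K t σ) * (B K t τ / ∑ σ ∈ T K, B K t σ))) ≤ ρ K := by
  obtain ⟨η, _, hs, hη⟩ := affinityDefectLetter_of_refreshProcesses_and_tameTilt T A B hA hB W hW bA hθA hΛθA hκA hCA
    UA wA ℓA PA hwA0 hwA hθPA hZA hmodelA bB hθB hΛθB hκB hCB UB wB ℓB PB hwB0 hwB hθPB hZB hmodelB r hr hrs h𝔅 htilt
  exact exists_summable_sqrt_rate hs hη

end Letter

/-! ## §2 The V-side capstone, regime-free: two refresh processes + ONE tame tilt + (R′) + (R‑c) ⇒ `HybridNE7` [by-name transfer through p623765] -/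
section Capstone
variable [DecidableEq ι] {l₀ vol : ℝ}

/-- **★★★ CAPSTONE, REGIME-FREE — `HybridNE7` FROM TWO REFRESH PROCESSES, ONE TAME TILT AND THE ENDPOINT RESPONSE** [folklore + by-name transfer: this seat's
p623765 `exists_hybridNE7_of_affinityDefectLetter_and_response` fed with §1].  On the carrier shapes of the key: positive class weights `A, B` DIFFERENTIABLE in the
source on `|s| ≤ l₀` (`0 ≤ l₀`, `0 < vol`) with derivative carriers `A', B'`, positive totals, the E1∕E2 dictionary for `Z`; wild sets `W K t ⊆ T K`; §1's letters —
two refresh processes with their own scalars and MODELLING letters ((V‑a)), radii `Σ 1∕r_K < ∞` ((V‑b) = (YG)), ONE bound `𝔅`, ONE tilt branch per `(K,t)` ((KR));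
the R-side — (R′) `|E_{q_{K,s}}[B'∕B − A'∕A]| ≤ R₁ K`, `Σ R₁ < ∞`, (R‑c) `Σ ½(p+q)(A'∕A − m_{K,s})² ≤ χ`.  Conclusion: `∃ η Wsh shA shB` with the (H) letter for `η`,
`Σ√η < ∞`, `0 ≤ Wsh ≤ √(2η)`, `Wsh < 1` at every key, and `HybridNE7 l₀ vol T A B (fun _ _ => ∅) (fun _ => 0) shA shB Wsh (K ↦ l₀·(R₁ K + 2√(2η_K)√χ)∕vol)` —
p623765 §3 with the regime `(K₀) (hreg)` and the second branch `φB` GONE. -/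
theorem exists_hybridNE7_of_refreshProcesses_tameTilt_and_response (hl₀ : 0 ≤ l₀) (hvol : 0 < vol)
    (T : ℕ → Finset ι) (A B : ℕ → ℝ → ι → ℝ)
    (hA : ∀ (K : ℕ) (t : ℝ), |t| ≤ l₀ → ∀ τ ∈ T K, 0 < A K t τ) (hB : ∀ (K : ℕ) (t : ℝ), |t| ≤ l₀ → ∀ τ ∈ T K, 0 < B K t τ)
    (hZA : ∀ (K : ℕ) (t : ℝ), |t| ≤ l₀ → 0 < ∑ τ ∈ T K, A K t τ) (hZB : ∀ (K : ℕ) (t : ℝ), |t| ≤ l₀ → 0 < ∑ τ ∈ T K, B K t τ)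
    {Z : ℕ → ℝ → ℝ} (hZA' : ∀ (K : ℕ) (t : ℝ), |t| ≤ l₀ → Z K t = ∑ τ ∈ T K, A K t τ)
    (hZB' : ∀ (K : ℕ) (t : ℝ), |t| ≤ l₀ → Z (K + 1) t = ∑ τ ∈ T K, B K t τ)
    {A' B' : ℕ → ℝ → ι → ℝ}
    (hdA : ∀ (K : ℕ) (s : ℝ), |s| ≤ l₀ → ∀ τ ∈ T K, HasDerivAt (fun u => A K u τ) (A' K s τ) s)
    (hdB : ∀ (K : ℕ) (s : ℝ), |s| ≤ l₀ → ∀ τ ∈ T K, HasDerivAt (fun u => B K u τ) (B' K s τ) s)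
    -- (V‑a): the two refresh processes, per-run scalars
    (W : ℕ → ℝ → Finset ι) (hW : ∀ K t, W K t ⊆ T K)
    {θA ΛA ζA κA ZA CA : ℝ} (bA : ℝ) (hθA : 0 ≤ θA) (hΛθA : ΛA + ζA < θA) (hκA : 2 < κA * (θA - ΛA - ζA)) (hCA : 0 ≤ CA)
    (UA : ℕ → ℝ → ℕ → Finset α) (wA ℓA PA : ℕ → ℝ → ℕ → α → ℝ)
    (hwA0 : ∀ K t m, ∀ j ∈ UA K t m, 0 ≤ wA K t m j)
    (hwA : ∀ K t m, ∀ j ∈ UA K t m, wA K t m j ≤ Real.exp (-PA K t m j))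
    (hθPA : ∀ K t m, ∀ j ∈ UA K t m, θA * ℓA K t m j ≤ PA K t m j / 2)
    (hZ0A : ∀ K t (m : ℕ), ∑ j ∈ UA K t m, Real.exp (-(PA K t m j / 2)) ≤ ZA + ζA * m)
    (hmodelA : ∀ (K : ℕ) (t : ℝ), |t| ≤ l₀ → 1 ≤ K → ∀ s : ℝ,
      (∀ M : ℕ, ∑ m ∈ range M, (if bA + κA * Real.log (K : ℝ) ≤ (m : ℝ) then
          Real.exp (ΛA * m) * ∑ S ∈ (UA K t m).powerset with ((m : ℝ) - bA ≤ ∑ j ∈ S, ℓA K t m j), ∏ j ∈ S, wA K t m j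
        else 0) ≤ s) →
      (∑ τ ∈ W K t, A K t τ) / (∑ σ ∈ T K, A K t σ) ≤ CA * s)
    {θB ΛB ζB κB ZB CB : ℝ} (bB : ℝ) (hθB : 0 ≤ θB) (hΛθB : ΛB + ζB < θB) (hκB : 2 < κB * (θB - ΛB - ζB)) (hCB : 0 ≤ CB)
    (UB : ℕ → ℝ → ℕ → Finset β) (wB ℓB PB : ℕ → ℝ → ℕ → β → ℝ)
    (hwB0 : ∀ K t m, ∀ j ∈ UB K t m, 0 ≤ wB K t m j)
    (hwB : ∀ K t m, ∀ j ∈ UB K t m, wB K t m j ≤ Real.exp (-PB K t m j))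
    (hθPB : ∀ K t m, ∀ j ∈ UB K t m, θB * ℓB K t m j ≤ PB K t m j / 2)
    (hZ0B : ∀ K t (m : ℕ), ∑ j ∈ UB K t m, Real.exp (-(PB K t m j / 2)) ≤ ZB + ζB * m)
    (hmodelB : ∀ (K : ℕ) (t : ℝ), |t| ≤ l₀ → 1 ≤ K → ∀ s : ℝ,
      (∀ M : ℕ, ∑ m ∈ range M, (if bB + κB * Real.log (K : ℝ) ≤ (m : ℝ) then
          Real.exp (ΛB * m) * ∑ S ∈ (UB K t m).powerset with ((m : ℝ) - bB ≤ ∑ j ∈ S, ℓB K t m j), ∏ j ∈ S, wB K t m j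
        else 0) ≤ s) →
      (∑ τ ∈ W K t, B K t τ) / (∑ σ ∈ T K, B K t σ) ≤ CB * s)
    -- (V‑b) ∕ (KR): radii, ONE bound, ONE tilt branch — NO regime
    (r : ℕ → ℝ) (hr : ∀ K, 0 < r K) (hrs : Summable fun K => 1 / r K)
    {𝔅 : ℝ} (h𝔅 : 0 ≤ 𝔅)
    (htilt : ∀ K t, |t| ≤ l₀ → ∃ φ : ℂ → ℂ,
      DifferentiableOn ℂ φ (Metric.closedBall 0 (r K)) ∧
      (∀ s ∈ Metric.closedBall (0:ℂ) (r K), Complex.exp (φ s)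
        = (∑ τ ∈ T K \ W K t, (A K t τ : ℂ) * Complex.exp (s * ((Real.log (B K t τ) - Real.log (A K t τ) : ℝ) : ℂ)))
            / ∑ τ ∈ T K \ W K t, (A K t τ : ℂ)) ∧
      (∀ s ∈ Metric.closedBall (0:ℂ) (r K), ‖φ s‖ ≤ 𝔅))
    -- the R-side: (R′) + (R‑c)
    {R₁ : ℕ → ℝ} {χ : ℝ} {m : ℕ → ℝ → ℝ}
    (hR : ∀ (K : ℕ) (s : ℝ), |s| ≤ l₀ →
      |∑ τ ∈ T K, B K s τ / (∑ σ ∈ T K, B K s σ) * (B' K s τ / B K s τ - A' K s τ / A K s τ)| ≤ R₁ K)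
    (hRs : Summable R₁)
    (hχ : ∀ (K : ℕ) (s : ℝ), |s| ≤ l₀ →
      ∑ τ ∈ T K, (A K s τ / (∑ σ ∈ T K, A K s σ) + B K s τ / (∑ σ ∈ T K, B K s σ)) / 2 * (A' K s τ / A K s τ - m K s) ^ 2 ≤ χ) :
    ∃ (η Wsh : ℕ → ℝ) (shA shB : ℕ → ℝ → ι → ℝ),
      (∀ (K : ℕ) (t : ℝ), |t| ≤ l₀ →
        1 - ∑ τ ∈ T K, Real.sqrt ((A K t τ / ∑ σ ∈ T K, A K t σ) * (B K t τ / ∑ σ ∈ T K, B K t σ)) ≤ η K) ∧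
      Summable (fun K => Real.sqrt (η K)) ∧
      (∀ K, 0 ≤ Wsh K ∧ Wsh K ≤ Real.sqrt (2 * η K) ∧ Wsh K < 1) ∧
      HybridNE7 l₀ vol T A B (fun _ _ => ∅) (fun _ => 0) shA shB Wsh
        (fun K => l₀ * (R₁ K + 2 * Real.sqrt (2 * η K) * Real.sqrt χ) / vol) :=
  exists_hybridNE7_of_affinityDefectLetter_and_response hl₀ hvol hA hB hZA hZB hZA' hZB' hdA hdB
    (affinityDefectLetter_of_refreshProcesses_and_tameTilt T A B hA hB W hW bA hθA hΛθA hκA hCA UA wA ℓA PA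
      hwA0 hwA hθPA hZ0A hmodelA bB hθB hΛθB hκB hCB UB wB ℓB PB hwB0 hwB hθPB hZ0B hmodelB r hr hrs h𝔅 htilt)
    hR hRs hχ

end Capstone

/-! ## §3 The same with (R‑c) replaced by a bounded source current [by-name transfer through p626582] -/
section BoundedCurrent
variable [DecidableEq ι] {l₀ vol : ℝ}

/-- **★★ CAPSTONE, REGIME-FREE, WITH A BOUNDED CURRENT** [folklore + by-name transfer: this seat's p626582
`exists_hybridNE7_of_affinityDefectLetter_response_boundedCurrent` fed with §1].  As `exists_hybridNE7_of_refreshProcesses_tameTilt_and_response` with the one-run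
susceptibility letter (R‑c) REPLACED by the bounded source current `|A' K s τ| ≤ M·A K s τ` on `T K` (`0 ≤ M`): the END-TO-END letter list of the refresh-process road
at a key is then (V‑a) refresh letters ×2 + modelling letters ×2 + radii + ONE tilt branch + `𝔅` + (R′) + bounded current, and the conclusion is `∃ η Wsh shA shB` with
the (H) letter, `Σ√η < ∞`, the budget bounds, and `HybridNE7 l₀ vol T A B (fun _ _ => ∅) (fun _ => 0) shA shB Wsh (K ↦ l₀·(R₁ K + 2√(2η_K)·M)∕vol)`. -/
theorem exists_hybridNE7_of_refreshProcesses_tameTilt_and_boundedCurrent (hl₀ : 0 ≤ l₀) (hvol : 0 < vol)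
    (T : ℕ → Finset ι) (A B : ℕ → ℝ → ι → ℝ)
    (hA : ∀ (K : ℕ) (t : ℝ), |t| ≤ l₀ → ∀ τ ∈ T K, 0 < A K t τ) (hB : ∀ (K : ℕ) (t : ℝ), |t| ≤ l₀ → ∀ τ ∈ T K, 0 < B K t τ)
    (hZA : ∀ (K : ℕ) (t : ℝ), |t| ≤ l₀ → 0 < ∑ τ ∈ T K, A K t τ) (hZB : ∀ (K : ℕ) (t : ℝ), |t| ≤ l₀ → 0 < ∑ τ ∈ T K, B K t τ)
    {Z : ℕ → ℝ → ℝ} (hZA' : ∀ (K : ℕ) (t : ℝ), |t| ≤ l₀ → Z K t = ∑ τ ∈ T K, A K t τ)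
    (hZB' : ∀ (K : ℕ) (t : ℝ), |t| ≤ l₀ → Z (K + 1) t = ∑ τ ∈ T K, B K t τ)
    {A' B' : ℕ → ℝ → ι → ℝ}
    (hdA : ∀ (K : ℕ) (s : ℝ), |s| ≤ l₀ → ∀ τ ∈ T K, HasDerivAt (fun u => A K u τ) (A' K s τ) s)
    (hdB : ∀ (K : ℕ) (s : ℝ), |s| ≤ l₀ → ∀ τ ∈ T K, HasDerivAt (fun u => B K u τ) (B' K s τ) s)
    (W : ℕ → ℝ → Finset ι) (hW : ∀ K t, W K t ⊆ T K)
    {θA ΛA ζA κA ZA CA : ℝ} (bA : ℝ) (hθA : 0 ≤ θA) (hΛθA : ΛA + ζA < θA) (hκA : 2 < κA * (θA - ΛA - ζA)) (hCA : 0 ≤ CA)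
    (UA : ℕ → ℝ → ℕ → Finset α) (wA ℓA PA : ℕ → ℝ → ℕ → α → ℝ)
    (hwA0 : ∀ K t m, ∀ j ∈ UA K t m, 0 ≤ wA K t m j)
    (hwA : ∀ K t m, ∀ j ∈ UA K t m, wA K t m j ≤ Real.exp (-PA K t m j))
    (hθPA : ∀ K t m, ∀ j ∈ UA K t m, θA * ℓA K t m j ≤ PA K t m j / 2)
    (hZ0A : ∀ K t (m : ℕ), ∑ j ∈ UA K t m, Real.exp (-(PA K t m j / 2)) ≤ ZA + ζA * m)
    (hmodelA : ∀ (K : ℕ) (t : ℝ), |t| ≤ l₀ → 1 ≤ K → ∀ s : ℝ,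
      (∀ M : ℕ, ∑ m ∈ range M, (if bA + κA * Real.log (K : ℝ) ≤ (m : ℝ) then
          Real.exp (ΛA * m) * ∑ S ∈ (UA K t m).powerset with ((m : ℝ) - bA ≤ ∑ j ∈ S, ℓA K t m j), ∏ j ∈ S, wA K t m j
        else 0) ≤ s) →
      (∑ τ ∈ W K t, A K t τ) / (∑ σ ∈ T K, A K t σ) ≤ CA * s)
    {θB ΛB ζB κB ZB CB : ℝ} (bB : ℝ) (hθB : 0 ≤ θB) (hΛθB : ΛB + ζB < θB) (hκB : 2 < κB * (θB - ΛB - ζB)) (hCB : 0 ≤ CB)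
    (UB : ℕ → ℝ → ℕ → Finset β) (wB ℓB PB : ℕ → ℝ → ℕ → β → ℝ)
    (hwB0 : ∀ K t m, ∀ j ∈ UB K t m, 0 ≤ wB K t m j)
    (hwB : ∀ K t m, ∀ j ∈ UB K t m, wB K t m j ≤ Real.exp (-PB K t m j))
    (hθPB : ∀ K t m, ∀ j ∈ UB K t m, θB * ℓB K t m j ≤ PB K t m j / 2)
    (hZ0B : ∀ K t (m : ℕ), ∑ j ∈ UB K t m, Real.exp (-(PB K t m j / 2)) ≤ ZB + ζB * m)
    (hmodelB : ∀ (K : ℕ) (t : ℝ), |t| ≤ l₀ → 1 ≤ K → ∀ s : ℝ,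
      (∀ M : ℕ, ∑ m ∈ range M, (if bB + κB * Real.log (K : ℝ) ≤ (m : ℝ) then
          Real.exp (ΛB * m) * ∑ S ∈ (UB K t m).powerset with ((m : ℝ) - bB ≤ ∑ j ∈ S, ℓB K t m j), ∏ j ∈ S, wB K t m j
        else 0) ≤ s) →
      (∑ τ ∈ W K t, B K t τ) / (∑ σ ∈ T K, B K t σ) ≤ CB * s)
    (r : ℕ → ℝ) (hr : ∀ K, 0 < r K) (hrs : Summable fun K => 1 / r K)
    {𝔅 : ℝ} (h𝔅 : 0 ≤ 𝔅)
    (htilt : ∀ K t, |t| ≤ l₀ → ∃ φ : ℂ → ℂ,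
      DifferentiableOn ℂ φ (Metric.closedBall 0 (r K)) ∧
      (∀ s ∈ Metric.closedBall (0:ℂ) (r K), Complex.exp (φ s)
        = (∑ τ ∈ T K \ W K t, (A K t τ : ℂ) * Complex.exp (s * ((Real.log (B K t τ) - Real.log (A K t τ) : ℝ) : ℂ)))
            / ∑ τ ∈ T K \ W K t, (A K t τ : ℂ)) ∧
      (∀ s ∈ Metric.closedBall (0:ℂ) (r K), ‖φ s‖ ≤ 𝔅))
    -- the R-side: (R′) + a bounded source current
    {R₁ : ℕ → ℝ} {M : ℝ} (hM : 0 ≤ M)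
    (hR : ∀ (K : ℕ) (s : ℝ), |s| ≤ l₀ →
      |∑ τ ∈ T K, B K s τ / (∑ σ ∈ T K, B K s σ) * (B' K s τ / B K s τ - A' K s τ / A K s τ)| ≤ R₁ K)
    (hRs : Summable R₁)
    (hcur : ∀ (K : ℕ) (s : ℝ), |s| ≤ l₀ → ∀ τ ∈ T K, |A' K s τ| ≤ M * A K s τ) :
    ∃ (η Wsh : ℕ → ℝ) (shA shB : ℕ → ℝ → ι → ℝ),
      (∀ (K : ℕ) (t : ℝ), |t| ≤ l₀ →
        1 - ∑ τ ∈ T K, Real.sqrt ((A K t τ / ∑ σ ∈ T K, A K t σ) * (B K t τ / ∑ σ ∈ T K, B K t σ)) ≤ η K) ∧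
      Summable (fun K => Real.sqrt (η K)) ∧
      (∀ K, 0 ≤ Wsh K ∧ Wsh K ≤ Real.sqrt (2 * η K) ∧ Wsh K < 1) ∧
      HybridNE7 l₀ vol T A B (fun _ _ => ∅) (fun _ => 0) shA shB Wsh
        (fun K => l₀ * (R₁ K + 2 * Real.sqrt (2 * η K) * M) / vol) :=
  exists_hybridNE7_of_affinityDefectLetter_response_boundedCurrent hl₀ hvol hA hB hZA hZB hZA' hZB' hdA hdB
    (affinityDefectLetter_of_refreshProcesses_and_tameTilt T A B hA hB W hW bA hθA hΛθA hκA hCA UA wA ℓA PA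
      hwA0 hwA hθPA hZ0A hmodelA bB hθB hΛθB hκB hCB UB wB ℓB PB hwB0 hwB hθPB hZ0B hmodelB r hr hrs h𝔅 htilt)
    hM hR hRs hcur

end BoundedCurrent

/-! ## §4 Toys (A6): §1 and §3 fire END TO END on the one-class carrier with two empty refresh processes [folklore] -/
section Toys

/-- [toy scalars] `θ = 10`, `Λ = 4 log 2`, `ζ = e^{−10}`, `κ₁ = 1`: `Λ + ζ < θ` and `κ₁(θ − Λ − ζ) > 2` (p622199 `toy_letters_inhabited`, re-derived). -/
theorem toy_scalars : (4 * Real.log 2 + Real.exp (-10) < 10) ∧ (2 < 1 * (10 - 4 * Real.log 2 - Real.exp (-10))) := by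
  have h2 : Real.log 2 < 0.6931471808 := Real.log_two_lt_d9
  have he : Real.exp (-10) ≤ 1 := Real.exp_le_one_iff.2 (by norm_num)
  exact ⟨by nlinarith, by nlinarith⟩

/-- [toy radii] `r_K = 2·2^K`: positive with `Σ_K 1∕r_K = Σ (1∕2)·(1∕2)^K < ∞`. -/
theorem toy_radii : (∀ K : ℕ, (0:ℝ) < 2 * 2 ^ K) ∧ Summable fun K : ℕ => 1 / ((2:ℝ) * 2 ^ K) := by
  refine ⟨fun K => by positivity, ?_⟩
  have h : (fun K : ℕ => 1 / ((2:ℝ) * 2 ^ K)) = fun K : ℕ => (1 / 2 : ℝ) * (1 / 2) ^ K := by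
    funext K; rw [one_div, mul_inv, ← inv_pow, one_div]
  rw [h]; exact summable_geometric_two.mul_left _

/-- **★ TOY — §1 END TO END ON TWO EMPTY REFRESH PROCESSES** (A6, contentful joint satisfiability).  One class (`ι = Unit`, `T K = univ`), both runs' class weight `1`,
no wild class (`W = ∅`), both refresh processes EMPTY (`U = ∅`, so the price ∕ rate letters are vacuous, the entropy letter reads `0 ≤ 0 + e^{−10} m`, and the
MODELLING letter reads `0∕1 ≤ 0·s`), scalars of `toy_scalars` with `Z₀ = C₀ = b = 0`, radii of `toy_radii`, the branch `φ = 0` on `closedBall 0 r_K`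
(`e^0 = (1·e^{z·0})∕1`), `𝔅 = 0`: EVERY antecedent of `affinityDefectLetter_of_refreshProcesses_and_tameTilt` is discharged by a genuine witness and the (H) letter
`∃ η ≥ 0, Σ√η < ∞, 1 − 𝒜_K(t) ≤ η_K` is exhibited (here `𝒜 = 1`). -/
theorem toy_affinityDefectLetter_emptyProcesses (l₀ : ℝ) :
    ∃ η : ℕ → ℝ, (∀ K, 0 ≤ η K) ∧ Summable (fun K => Real.sqrt (η K)) ∧
      ∀ (K : ℕ) (t : ℝ), |t| ≤ l₀ →
        1 - ∑ τ ∈ (fun _ : ℕ => (univ : Finset Unit)) K,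
          Real.sqrt (((fun (_ : ℕ) (_ : ℝ) (_ : Unit) => (1:ℝ)) K t τ / ∑ σ ∈ (fun _ : ℕ => (univ : Finset Unit)) K, (fun (_ : ℕ) (_ : ℝ) (_ : Unit) => (1:ℝ)) K t σ)
            * ((fun (_ : ℕ) (_ : ℝ) (_ : Unit) => (1:ℝ)) K t τ / ∑ σ ∈ (fun _ : ℕ => (univ : Finset Unit)) K, (fun (_ : ℕ) (_ : ℝ) (_ : Unit) => (1:ℝ)) K t σ))
          ≤ η K := by
  obtain ⟨hΛθ, hκ⟩ := toy_scalars
  obtain ⟨hr, hrs⟩ := toy_radii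
  refine affinityDefectLetter_of_refreshProcesses_and_tameTilt (α := Unit) (β := Unit) (fun _ => (univ : Finset Unit))
    (fun _ _ _ => (1:ℝ)) (fun _ _ _ => (1:ℝ)) (fun _ _ _ _ _ => one_pos) (fun _ _ _ _ _ => one_pos) (fun _ _ => ∅) (fun _ _ => empty_subset _)
    -- run A: the empty process
    (θA := 10) (ΛA := 4 * Real.log 2) (ζA := Real.exp (-10)) (κA := 1) (ZA := 0) (CA := 0) 0 (by norm_num) hΛθ hκ le_rfl
    (fun _ _ _ => ∅) (fun _ _ _ _ => 0) (fun _ _ _ _ => 0) (fun _ _ _ _ => 0)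
    (fun _ _ _ j hj => absurd hj (notMem_empty j)) (fun _ _ _ j hj => absurd hj (notMem_empty j))
    (fun _ _ _ j hj => absurd hj (notMem_empty j)) (fun _ _ m => ?_) (fun K t _ _ s _ => ?_)
    -- run B: the empty process
    (θB := 10) (ΛB := 4 * Real.log 2) (ζB := Real.exp (-10)) (κB := 1) (ZB := 0) (CB := 0) 0 (by norm_num) hΛθ hκ le_rfl
    (fun _ _ _ => ∅) (fun _ _ _ _ => 0) (fun _ _ _ _ => 0) (fun _ _ _ _ => 0)
    (fun _ _ _ j hj => absurd hj (notMem_empty j)) (fun _ _ _ j hj => absurd hj (notMem_empty j))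
    (fun _ _ _ j hj => absurd hj (notMem_empty j)) (fun _ _ m => ?_) (fun K t _ _ s _ => ?_)
    -- radii, bound, branch
    (fun K => 2 * 2 ^ K) hr hrs (𝔅 := 0) le_rfl (fun K t _ => ⟨fun _ => 0, differentiableOn_const 0, fun s _ => ?_, fun s _ => by simp⟩)
  · rw [sum_empty]; positivity
  · simp
  · rw [sum_empty]; positivity
  · simp
  · simp

/-- **★ TOY — `HybridNE7` INHABITED THROUGH THE WHOLE ROAD** (A6: §3 fires END TO END).  The carrier of `toy_affinityDefectLetter_emptyProcesses` with source-CONSTANT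
weights (`A = B = 1`, derivative carriers `A' = B' = 0`, `Z ≡ 1`), window `l₀ = 0`, `vol = 1`, (R′) with `R₁ = 0`, bounded current with `M = 0`: every antecedent of
`exists_hybridNE7_of_refreshProcesses_tameTilt_and_boundedCurrent` is discharged and `∃ η Wsh shA shB, … ∧ HybridNE7 0 1 T A B (∅) 0 shA shB Wsh (K ↦ 0·(0 + 2√(2η_K)·0)∕1)`
is exhibited — the composition of p621610 → p622199 → dag-n19-w4 g8 → p619159 → p609004 → p623765 → p626582 → this file FIRES on a genuine (trivial) instance. -/
theorem toy_hybridNE7_emptyProcesses :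
    ∃ (η Wsh : ℕ → ℝ) (shA shB : ℕ → ℝ → Unit → ℝ),
      (∀ (K : ℕ) (t : ℝ), |t| ≤ 0 →
        1 - ∑ τ ∈ (fun _ : ℕ => (univ : Finset Unit)) K,
          Real.sqrt (((fun (_ : ℕ) (_ : ℝ) (_ : Unit) => (1:ℝ)) K t τ / ∑ σ ∈ (fun _ : ℕ => (univ : Finset Unit)) K, (fun (_ : ℕ) (_ : ℝ) (_ : Unit) => (1:ℝ)) K t σ)
            * ((fun (_ : ℕ) (_ : ℝ) (_ : Unit) => (1:ℝ)) K t τ / ∑ σ ∈ (fun _ : ℕ => (univ : Finset Unit)) K, (fun (_ : ℕ) (_ : ℝ) (_ : Unit) => (1:ℝ)) K t σ))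
          ≤ η K) ∧
      Summable (fun K => Real.sqrt (η K)) ∧
      (∀ K, 0 ≤ Wsh K ∧ Wsh K ≤ Real.sqrt (2 * η K) ∧ Wsh K < 1) ∧
      HybridNE7 0 1 (fun _ : ℕ => (univ : Finset Unit)) (fun _ _ _ => (1:ℝ)) (fun _ _ _ => (1:ℝ)) (fun _ _ => ∅) (fun _ => 0) shA shB Wsh
        (fun K => 0 * ((fun _ : ℕ => (0:ℝ)) K + 2 * Real.sqrt (2 * η K) * 0) / 1) := by
  obtain ⟨hΛθ, hκ⟩ := toy_scalars
  obtain ⟨hr, hrs⟩ := toy_radii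
  have huniv : ∑ σ ∈ (univ : Finset Unit), (1:ℝ) = 1 := by simp
  refine exists_hybridNE7_of_refreshProcesses_tameTilt_and_boundedCurrent (α := Unit) (β := Unit) le_rfl one_pos
    (fun _ => (univ : Finset Unit)) (fun _ _ _ => (1:ℝ)) (fun _ _ _ => (1:ℝ)) (fun _ _ _ _ _ => one_pos) (fun _ _ _ _ _ => one_pos)
    (fun _ _ _ => by rw [huniv]; exact one_pos) (fun _ _ _ => by rw [huniv]; exact one_pos)
    (Z := fun _ _ => 1) (fun _ _ _ => huniv.symm) (fun _ _ _ => huniv.symm)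
    (A' := fun _ _ _ => 0) (B' := fun _ _ _ => 0) (fun _ s _ _ _ => hasDerivAt_const s (1:ℝ)) (fun _ s _ _ _ => hasDerivAt_const s (1:ℝ))
    (fun _ _ => ∅) (fun _ _ => empty_subset _)
    (θA := 10) (ΛA := 4 * Real.log 2) (ζA := Real.exp (-10)) (κA := 1) (ZA := 0) (CA := 0) 0 (by norm_num) hΛθ hκ le_rfl
    (fun _ _ _ => ∅) (fun _ _ _ _ => 0) (fun _ _ _ _ => 0) (fun _ _ _ _ => 0)
    (fun _ _ _ j hj => absurd hj (notMem_empty j)) (fun _ _ _ j hj => absurd hj (notMem_empty j))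
    (fun _ _ _ j hj => absurd hj (notMem_empty j)) (fun _ _ m => ?_) (fun K t _ _ s _ => ?_)
    (θB := 10) (ΛB := 4 * Real.log 2) (ζB := Real.exp (-10)) (κB := 1) (ZB := 0) (CB := 0) 0 (by norm_num) hΛθ hκ le_rfl
    (fun _ _ _ => ∅) (fun _ _ _ _ => 0) (fun _ _ _ _ => 0) (fun _ _ _ _ => 0)
    (fun _ _ _ j hj => absurd hj (notMem_empty j)) (fun _ _ _ j hj => absurd hj (notMem_empty j))
    (fun _ _ _ j hj => absurd hj (notMem_empty j)) (fun _ _ m => ?_) (fun K t _ _ s _ => ?_)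
    (fun K => 2 * 2 ^ K) hr hrs (𝔅 := 0) le_rfl (fun K t _ => ⟨fun _ => 0, differentiableOn_const 0, fun s _ => ?_, fun s _ => by simp⟩)
    (R₁ := fun _ => 0) (M := 0) le_rfl (fun _ _ _ => by simp) summable_zero (fun _ _ _ _ _ => by simp)
  · rw [sum_empty]; positivity
  · simp
  · rw [sum_empty]; positivity
  · simp
  · simp

end Toys
end Summit.QuantumFields.YangMills.BalabanUVNodes.N20RefreshProcessRoadRegimeFree

end
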